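import Summits.HodgeConjecture.HodgeConjecture.Theorems.LinearSystemTorelliMiddleDivisorSupportFourfoldOfDominantQbarEnvelope
import Literature.AlgebraicGeometry.HodgeTheory.AndreottiFrankelAffine
import Literature.AlgebraicTopology.SingularHomology.UniversalCoefficientsField

/-!
# Route `LinearSystemTorelli` — crux `MiddleDivisorSupportFourfold` (stmt-HodgeConjecture-2409),
# line `IdeatorFiveSketch`, stub E (`stub_qbarDivisorSupportCodimTwo`): the case `m ≤ 3`

Helper file for the crux item stmt-HodgeConjecture-2409 (`--supports`; it closes nothing), line
`IdeatorFiveSketch` (idea `weakly-nonfactor-descent`), lead c4. Stub E of the registered skeleton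
asks: for a fixed `σ : ℚ̄ →+* ℂ`, every rational `(2,2)`-class `c' ∈ H⁴(W₀ ⊗_σ ℂ; ℂ)` on the
complexification of a `ℚ̄`-scheme `W₀` with `W₀ ⊗_σ ℂ` smooth projective of dimension `m` dies off
`π⁻¹ Z₀` for some PROPER Zariski-closed `Z₀ ⊊ W₀` (`π : W₀ ⊗_σ ℂ ⟶ W₀` the projection). In general
this is the Hodge conjecture over `ℚ̄` in codimension `2` in support form (open; stmt-11596 modulo
the named fact `charlesSchnell2014_algebraicClasses_supportedOn_qbarClosed`,
`linearSystemTorelli_qbarDivisorSupport_of_hodgeConjectureQbar`).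

This file proves E UNCONDITIONALLY for `m ≤ 3` — and for EVERY class in `H⁴`, rational or not,
Hodge or not — so that E's open content is recorded, kernel-checked, as exactly `m ≥ 4`:

* `linearSystemTorelli_qbarDivisorSupportCodimTwo_of_le_three`: for `m ≤ 3`, every
  `c' ∈ H⁴((W₀ ⊗_σ ℂ)(ℂ); ℂ)` restricts to `0` on the complex points off `π⁻¹ Z₀`, where
  `Z₀ = W₀ ∖ U₀` for a nonempty affine open `U₀ ⊆ W₀` (it exists: `W₀` is irreducible, being the
  continuous image of the irreducible `W₀ ⊗_σ ℂ`). Indeed `π⁻¹ U₀ = U₀ ⊗_σ ℂ` is an affine open of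
  the smooth `m`-fold `W₀ ⊗_σ ℂ` (`π` is affine, a base change of `Spec ℂ → Spec ℚ̄`), so by
  Andreotti–Frankel (Voisin II Thm. 1.22, the tree's
  `AffineCoordinates.isZero_singularHomology_setOf_pt_mem_affineOpen`) the complex points over it
  have `H₄ = 0` (`4 ≥ m + 1`), hence `H⁴ = 0` by universal coefficients over the field `ℂ`
  (`kroneckerPairing_bijective_of_field`, Hatcher Thm. 3.2).
* `linearSystemTorelli_stub_qbarDivisorSupportCodimTwo_of_le_three`: the same in the exact binder
  shape of stub E, restricted to `m ≤ 3`.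

Everything here is proved; no definitions, no named facts.
-/

noncomputable section

universe u

namespace Summit.HodgeConjecture.HodgeConjecture.Theorems

open CategoryTheory CategoryTheory.Limits AlgebraicGeometry Topology
open Literature.AlgebraicGeometry Literature.AlgebraicGeometry.Motives
open Literature.AlgebraicGeometry.HodgeTheory
open Literature.AlgebraicTopology.SingularHomology

/-- **Over the field `ℂ`, `Hₙ(Y; ℂ) = 0` implies `Hⁿ(Y; ℂ) = 0`** (universal coefficients over a
field: the Kronecker map `Hⁿ(Y; ℂ) → Hom(Hₙ(Y; ℂ), ℂ)` is bijective, Hatcher Thm. 3.2 with p. 198;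
the tree's `kroneckerPairing_bijective_of_field`). [cite: HatcherAT2002, §3.1 Thm. 3.2 (p. 198)] -/
theorem linearSystemTorelli_isZero_singularCohomology_of_isZero_singularHomology
    {Y : Type} [TopologicalSpace Y] (n : ℕ) (h : IsZero (singularHomology ℂ ℂ Y n)) :
    IsZero (singularCohomology ℂ ℂ Y n) := by
  haveI := ModuleCat.subsingleton_of_isZero h
  haveI : Subsingleton (singularHomology ℂ ℂ Y n →ₗ[ℂ] ℂ) :=
    ⟨fun f g => LinearMap.ext fun x => by rw [Subsingleton.elim x 0, map_zero, map_zero]⟩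
  haveI : Subsingleton (singularCohomology ℂ ℂ Y n) :=
    (kroneckerPairing_bijective_of_field ℂ Y n).1.subsingleton
  exact ModuleCat.isZero_of_subsingleton _

/-- The projection `π : W₀ ⊗_σ L ⟶ W₀` is an affine morphism: it is a base change of the affine
morphism `Spec L ⟶ Spec k` (affine morphisms are stable under base change, Mathlib
`isAffineHom_isStableUnderBaseChange`). [folklore] -/
theorem linearSystemTorelli_isAffineHom_baseChangeHomFst {k L : Type u} [CommRing k] [CommRing L]
    (σ : k →+* L) (W₀ : SchemeOver k) : IsAffineHom (baseChangeHomFst σ W₀) :=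
  MorphismProperty.pullback_fst (P := @IsAffineHom) _ _ inferInstance

/-- **Andreotti–Frankel over a `ℚ̄`-affine open, cohomological form.** For `W₀` over `ℚ̄` with
`W₀ ⊗_σ ℂ` smooth projective of dimension `m` and `U₀ ⊆ W₀` an affine open, the complex points of
`W₀ ⊗_σ ℂ` off `π⁻¹(W₀ ∖ U₀)`, i.e. over the affine open `π⁻¹ U₀ = U₀ ⊗_σ ℂ`, have `Hʲ(-; ℂ) = 0`
for `j ≥ m + 1` (Voisin II Thm. 1.22 in homology, the tree's
`AffineCoordinates.isZero_singularHomology_setOf_pt_mem_affineOpen`, and universal coefficients over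
`ℂ`). [cite: VoisinHodgeII2003, §1.2.2 Thm. 1.22 (PDF p. 59)] -/
theorem linearSystemTorelli_isZero_singularCohomology_complexPointsCompl_preimage_compl
    (σ : AlgebraicClosure ℚ →+* ℂ) {m : ℕ} (W₀ : SchemeOver (AlgebraicClosure ℚ))
    (hW : IsSmoothProjective m ((baseChangeHom σ).obj W₀)) {U₀ : W₀.left.Opens}
    (hU₀ : IsAffineOpen U₀) {j : ℕ} (hj : m + 1 ≤ j) :
    IsZero (singularCohomology ℂ ℂ
      (complexPointsCompl ((baseChangeHom σ).obj W₀)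
        ((baseChangeHomFst σ W₀).base ⁻¹' (U₀ : Set W₀.left)ᶜ)) j) := by
  set W := (baseChangeHom σ).obj W₀ with hWdef
  haveI := hW.smoothOfRelativeDimension
  haveI : LocallyOfFiniteType W.hom := locallyOfFiniteType_of_isSmoothProjective hW
  haveI := linearSystemTorelli_isAffineHom_baseChangeHomFst σ W₀
  -- `π⁻¹ U₀` is an affine open of `W`
  have hV : IsAffineOpen (baseChangeHomFst σ W₀ ⁻¹ᵁ U₀) := hU₀.preimage _
  have h0 : IsZero (singularHomology ℂ ℂ
      ↥{P : ComplexPoints W | P.pt ∈ (baseChangeHomFst σ W₀ ⁻¹ᵁ U₀ : Set W.left)} j) :=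
    AffineCoordinates.isZero_singularHomology_setOf_pt_mem_affineOpen W _ hV hj
  -- the complex points over `π⁻¹ U₀` are exactly those off `π⁻¹ (W₀ ∖ U₀)`
  have hset : {P : ComplexPoints W | P.pt ∈ (baseChangeHomFst σ W₀ ⁻¹ᵁ U₀ : Set W.left)} =
      {P : ComplexPoints W | P.pt ∉ (baseChangeHomFst σ W₀).base ⁻¹' (U₀ : Set W₀.left)ᶜ} := by
    ext P
    simp
  let e : ↥{P : ComplexPoints W | P.pt ∈ (baseChangeHomFst σ W₀ ⁻¹ᵁ U₀ : Set W.left)} ≃ₜ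
      complexPointsCompl W ((baseChangeHomFst σ W₀).base ⁻¹' (U₀ : Set W₀.left)ᶜ) :=
    Homeomorph.setCongr hset
  have h1 : IsZero (singularHomology ℂ ℂ
      (complexPointsCompl W ((baseChangeHomFst σ W₀).base ⁻¹' (U₀ : Set W₀.left)ᶜ)) j) :=
    h0.of_iso ((HomologicalComplex.homologyFunctor _ _ j).mapIso
      (singularChainComplex.mapHomeomorph ℂ ℂ e)).symm
  exact linearSystemTorelli_isZero_singularCohomology_of_isZero_singularHomology j h1

/-- **Stub E of line `IdeatorFiveSketch` holds unconditionally in dimension `m ≤ 3`** (and for every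
class in `H⁴`, with no rationality or Hodge-type hypothesis): for `W₀` over `ℚ̄` with `W₀ ⊗_σ ℂ`
smooth projective of dimension `m ≤ 3`, every `c' ∈ H⁴((W₀ ⊗_σ ℂ)(ℂ); ℂ)` dies off `π⁻¹ Z₀` for the
proper Zariski-closed `Z₀ = W₀ ∖ U₀ ⊊ W₀`, `U₀` any nonempty affine open of the irreducible `W₀`:
`π⁻¹ U₀` is an affine open of the smooth `m`-fold `W₀ ⊗_σ ℂ`, so its complex points have `H⁴ = 0` by
Andreotti–Frankel (`4 ≥ m + 1`). Hence the open content of stub E is exactly `m ≥ 4`.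
[cite: VoisinHodgeII2003, §1.2.2 Thm. 1.22 (PDF p. 59)] -/
theorem linearSystemTorelli_qbarDivisorSupportCodimTwo_of_le_three
    (σ : AlgebraicClosure ℚ →+* ℂ) ⦃m : ℕ⦄ (hm : m ≤ 3) (W₀ : SchemeOver (AlgebraicClosure ℚ))
    (hW : IsSmoothProjective m ((baseChangeHom σ).obj W₀))
    (c' : complexBetti ((baseChangeHom σ).obj W₀) 4) :
    ∃ Z₀ : Set W₀.left, IsClosed Z₀ ∧ Z₀ ≠ Set.univ ∧
      complexBetti.restrictCompl ((baseChangeHom σ).obj W₀)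
        ((baseChangeHomFst σ W₀).base ⁻¹' Z₀) 4 c' = 0 := by
  -- `W₀` is irreducible (the continuous image of the irreducible `W₀ ⊗_σ ℂ`), hence nonempty
  haveI := irreducibleSpace_of_isSmoothProjective' hW
  haveI := irreducibleSpace_of_irreducibleSpace_baseChangeHom_obj σ W₀
  obtain ⟨x⟩ := (inferInstance : Nonempty W₀.left)
  -- a nonempty affine open `U₀ ∋ x` of `W₀`
  obtain ⟨U₀, hU₀, hxU₀, -⟩ :=
    exists_isAffineOpen_mem_and_subset (X := W₀.left) (x := x) (U := ⊤) trivial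
  refine ⟨(U₀ : Set W₀.left)ᶜ, U₀.isOpen.isClosed_compl, fun h => ?_, ?_⟩
  · have hx : x ∈ (U₀ : Set W₀.left)ᶜ := h ▸ Set.mem_univ x
    exact hx hxU₀
  · -- the target `H⁴` of the restriction map is the zero module
    haveI := ModuleCat.subsingleton_of_isZero
      (linearSystemTorelli_isZero_singularCohomology_complexPointsCompl_preimage_compl σ W₀ hW hU₀
        (j := 4) (by omega))
    exact Subsingleton.elim _ _

/-- **Stub E (`stub_qbarDivisorSupportCodimTwo`) of line `IdeatorFiveSketch`, in its exact binder
shape, restricted to `m ≤ 3`** — unconditional (the rationality and Hodge-type hypotheses are not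
used: for `m ≤ 3` every class in `H⁴` dies off the preimage of a proper `ℚ̄`-closed subset, by
Andreotti–Frankel). [cite: VoisinHodgeII2003, §1.2.2 Thm. 1.22 (PDF p. 59)] -/
theorem linearSystemTorelli_stub_qbarDivisorSupportCodimTwo_of_le_three :
    ∀ (σ : AlgebraicClosure ℚ →+* ℂ) ⦃m : ℕ⦄, m ≤ 3 → ∀ (W₀ : SchemeOver (AlgebraicClosure ℚ)),
      IsSmoothProjective m ((baseChangeHom σ).obj W₀) →
      ∀ (c' : complexBetti ((baseChangeHom σ).obj W₀) 4), IsRationalClass c' →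
        IsOfHodgeType m ((baseChangeHom σ).obj W₀) 4 2 2 c' →
          ∃ Z₀ : Set W₀.left, IsClosed Z₀ ∧ Z₀ ≠ Set.univ ∧
            complexBetti.restrictCompl ((baseChangeHom σ).obj W₀)
              ((baseChangeHomFst σ W₀).base ⁻¹' Z₀) 4 c' = 0 :=
  fun σ _ hm W₀ hW c' _ _ =>
    linearSystemTorelli_qbarDivisorSupportCodimTwo_of_le_three σ hm W₀ hW c'

end Summit.HodgeConjecture.HodgeConjecture.Theorems

end
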